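import Literature.Topology.FourManifolds.CollarUniquenessBall
import Literature.Topology.FourManifolds.SeamAdaptedWitnesses
import HarnessLib

/-!
# Collar germs: definition, log-slow blend, height calculus, fibrewise inverse, bounds

Fourth file of the proof of the tree's named fact
`Literature.Topology.FourManifolds.nonempty_diffeomorph_of_isBoundaryGluing` (`Gluing.lean`;
Hirsch (1976), Ch. 8, Thm. 2.1 / Thm. 1.9; Bröcker–Jänich (1982), (13.9) with (13.7)).  It is
independent of gluings: everything takes place in the half cylinder `Σ × [0, ∞)` over a
compact manifold `Σ` without boundary (in the application, `Σ = ∂M`).  This file sets up the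
objects and the analysis; **the extension theorem itself (`CollarGerm.exists_extension`,
uniqueness of collars in germ form) is proved in the sequel `CollarGermExtension.lean`.**

**The setting** (`CollarGerm`).  A *germ of a collar embedding* along `Σ × {0}` is a map `Γ`
of `Σ × ℝ` which is `C^∞` on a slab `Σ × [0, δ)` in the within sense, fixes `Σ × {0}`
pointwise, carries the slab into the closed upper half cylinder and has there a within-`C^∞`
inverse `Ψ`, and whose height `pr₂ ∘ Γ` is the restriction of a `C^∞` function `ρ` on
`Σ × ℝ`.  (This is the germ of the comparison `κ₁⁻¹ ∘ κ₀` of two collars, Bröcker–Jänich,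
*Introduction to Differential Topology* (1982), (13.5)/(13.7); Hirsch, *Differential Topology*
(1976), Ch. 8 §1, remark before Thm. 1.9.)  The sequel proves that such a germ extends to a
bijection `S` of `Σ × (0, ∞)`, `C^∞` with `C^∞` inverse, equal to `Γ` near the bottom and to
the identity above a level `a₁ < δ` — flow-free, as `S = S_lev ∘ S_rep` with a
level-preserving part and a *fibre reparametrisation* built from the **log-slow blend**
`β_x t = exp (ℓ_L t · log ρ(x, t) + (1 - ℓ_L t) · log t)` of `ρ (x, ·)` (near `0`) with the
identity (above `e^{-L}`), `ℓ_L` the log-slow cutoff of `CollarUniquenessBall.lean`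
(`|t ℓ_L'(t)| ≤ C₀ / L`).  The present file supplies what that construction needs:

## Main statements

* `logBlend`, `logBlend_eq_of_le`, `logBlend_eq_self`, `hasDerivAt_logBlend`,
  `logBlend_deriv_factor_pos`: the one-variable blend and the positivity of its derivative
  when `ρ (x, t) / t` and `∂ₜρ` are bounded above and below and `L` is large.
* `partialT`, `hasDerivAt_partialT`, `continuous_partialT`, `exists_partialT_eq_slope`:
  the normal (`t`-) derivative of a `C^∞` function on `Σ × ℝ`, through charts
  (`contDiffOn_of_contMDiffOn_prodSelf`, a private copy of the tree's
  `contDiffOn_of_contMDiffOn_prod_self` of `CircleFamilyCoordinates.lean` kept here to avoid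
  importing the circle-family files, and its converse `contMDiffOn_prod_self_of_contDiffOn`).
* `exists_prod_Ioo_subset_of_isOpen`, `exists_forall_mem_of_continuousOn`: tube lemma and
  uniform bounds over the compact `Σ`.
* `exists_fibrewise_inverse`: smooth inverses of fibrewise strictly monotone smooth families
  (inverse function theorem in charts, `exists_openPartialHomeomorph_of_injOn`).
* `CollarGerm`, `CollarGerm.partialT_height_zero_pos` (the normal derivative of the height is
  positive along `Σ × {0}`), `CollarGerm.exists_bounds` (uniform two-sided bounds for
  `height / t` and `∂ₜ height` near `Σ × {0}`).

## References

* Th. Bröcker, K. Jänich, *Introduction to Differential Topology*, CUP (1982), (13.7)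
  (uniqueness of collars), (13.9) (held copy, PDF pp. 84–86). [BrockerJanich1982]
* M. W. Hirsch, *Differential Topology*, GTM 33 (1976), Ch. 8 §1, Thm. 1.8 and the remark on
  collars before Thm. 1.9 (held copy, PDF p. 168). [HirschDT1976]
-/

open scoped Manifold ContDiff Topology
open Set Function Metric Filter Topology Real

noncomputable section

namespace Literature.Topology.FourManifolds

/-! ### §1 The log-slow blend of a function with the identity -/

section Blend

/-- The **log-slow blend** of `r : ℝ → ℝ` with the identity at scale `L`:
`exp (ℓ_L t · log (r t) + (1 - ℓ_L t) · log t)`, equal to `r t` for `0 < t ≤ e^{-2L}` (where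
`r t > 0`) and to `t` for `t ≥ e^{-L}`. [folklore] -/
def logBlend (L : ℝ) (r : ℝ → ℝ) (t : ℝ) : ℝ :=
  exp (logCutoff L t * log (r t) + (1 - logCutoff L t) * log t)

variable {L : ℝ} {r : ℝ → ℝ} {t : ℝ}

/-- The blend is positive. [folklore] -/
theorem logBlend_pos (L : ℝ) (r : ℝ → ℝ) (t : ℝ) : 0 < logBlend L r t := exp_pos _

/-- Near `0` the blend is `r`: for `0 < t ≤ e^{-2L}` with `r t > 0`. [folklore] -/
theorem logBlend_eq_of_le (hL : 0 < L) (ht : 0 < t) (htL : t ≤ exp (-2 * L)) (hr : 0 < r t) :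
    logBlend L r t = r t := by
  rw [logBlend, logCutoff_eq_one hL ht htL]
  simp [exp_log hr]

/-- Above `e^{-L}` the blend is the identity. [folklore] -/
theorem logBlend_eq_self (hL : 0 < L) (htL : exp (-L) ≤ t) : logBlend L r t = t := by
  have ht : 0 < t := (exp_pos _).trans_le htL
  rw [logBlend, logCutoff_eq_zero hL htL]
  simp [exp_log ht]

/-- **Derivative of the blend** at `t > 0` with `r t > 0`: `β' = β · D` with
`D = ℓ' (log r - log t) + ℓ r'/r + (1 - ℓ)/t`. [folklore] -/
theorem hasDerivAt_logBlend {r' : ℝ} (ht : 0 < t) (hr : 0 < r t) (hrd : HasDerivAt r r' t) :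
    HasDerivAt (logBlend L r)
      (logBlend L r t * (deriv (logCutoff L) t * (log (r t) - log t) +
        logCutoff L t * (r' / r t) + (1 - logCutoff L t) * t⁻¹)) t := by
  have hℓ : HasDerivAt (logCutoff L) (deriv (logCutoff L) t) t :=
    (hasDerivAt_logCutoff ht.ne').differentiableAt.hasDerivAt
  have hlogr : HasDerivAt (fun t => log (r t)) (r' / r t) t := by
    simpa [div_eq_inv_mul] using hrd.log hr.ne'
  have hlogt : HasDerivAt log t⁻¹ t := hasDerivAt_log ht.ne'
  have hinner : HasDerivAt (fun t => logCutoff L t * log (r t) + (1 - logCutoff L t) * log t)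
      (deriv (logCutoff L) t * log (r t) + logCutoff L t * (r' / r t) +
        (-deriv (logCutoff L) t * log t + (1 - logCutoff L t) * t⁻¹)) t :=
    (hℓ.mul hlogr).add ((hℓ.const_sub 1).mul hlogt)
  have := hinner.exp
  have heq : logBlend L r =
      fun t => exp (logCutoff L t * log (r t) + (1 - logCutoff L t) * log t) := rfl
  rw [heq]
  convert this using 1
  ring

/-- **Positivity of the derivative of the blend.** If on `r t / t ∈ [c₁, c₂]` and
`m ≤ r' ≤ Λ₁`-type bounds hold at `t` — precisely `0 < c₁ ≤ r t / t ≤ c₂` and `0 < m ≤ r'` —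
and `L` is so large that `C₀ Λ / L ≤ min (m / c₂, 1) / 2` with `Λ = max |log c₁| |log c₂|`,
then the factor `D` of `hasDerivAt_logBlend` is positive. [folklore] -/
theorem logBlend_deriv_factor_pos {r' c₁ c₂ m : ℝ} (hL : 0 < L) (ht : 0 < t) (hc₁ : 0 < c₁)
    (hlo : c₁ ≤ r t / t) (hhi : r t / t ≤ c₂) (hm : 0 < m) (hr' : m ≤ r')
    (hLarge : smoothTransitionDerivBound * max |log c₁| |log c₂| / L ≤ min (m / c₂) 1 / 2) :
    0 < deriv (logCutoff L) t * (log (r t) - log t) +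
        logCutoff L t * (r' / r t) + (1 - logCutoff L t) * t⁻¹ := by
  have hc₂ : 0 < c₂ := hc₁.trans_le (hlo.trans hhi)
  have hrt : 0 < r t := by
    have : 0 < r t / t := hc₁.trans_le hlo
    exact (div_pos_iff_of_pos_right ht).1 this
  set ℓ := logCutoff L t with hℓ
  have hℓ0 : 0 ≤ ℓ := logCutoff_nonneg L t
  have hℓ1 : ℓ ≤ 1 := logCutoff_le_one L t
  -- the three terms, multiplied by `t`
  -- (1) `|t ℓ' (log r - log t)| ≤ (C₀ / L) Λ`
  have hlog : log (r t) - log t = log (r t / t) := by rw [log_div hrt.ne' ht.ne']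
  have hΛ : |log (r t / t)| ≤ max |log c₁| |log c₂| := by
    rw [abs_le]
    constructor
    · have h1 : log c₁ ≤ log (r t / t) := log_le_log hc₁ hlo
      have h2 : -max |log c₁| |log c₂| ≤ log c₁ := by
        have := neg_abs_le (log c₁)
        have := le_max_left |log c₁| |log c₂|
        linarith
      linarith
    · have h1 : log (r t / t) ≤ log c₂ := log_le_log (hc₁.trans_le hlo) hhi
      exact h1.trans ((le_abs_self _).trans (le_max_right _ _))
  have h1 : |t * (deriv (logCutoff L) t * (log (r t) - log t))| ≤
      smoothTransitionDerivBound / L * max |log c₁| |log c₂| := by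
    rw [hlog, ← mul_assoc, abs_mul]
    exact mul_le_mul (abs_mul_deriv_logCutoff_le hL ht.ne') hΛ (abs_nonneg _)
      (div_nonneg smoothTransitionDerivBound_pos.le hL.le)
  -- (2) `t ℓ r'/r ≥ ℓ m / c₂`
  have h2 : ℓ * (m / c₂) ≤ t * (ℓ * (r' / r t)) := by
    have hrt' : r t ≤ c₂ * t := by rwa [div_le_iff₀ ht] at hhi
    have : m / c₂ ≤ t * (r' / r t) := by
      rw [div_le_iff₀ hc₂, show t * (r' / r t) * c₂ = r' * (c₂ * t) / r t by ring,
        le_div_iff₀ hrt]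
      calc m * r t ≤ m * (c₂ * t) := by gcongr
        _ ≤ r' * (c₂ * t) := by gcongr
    calc ℓ * (m / c₂) ≤ ℓ * (t * (r' / r t)) := by gcongr
      _ = t * (ℓ * (r' / r t)) := by ring
  -- (3) `t (1 - ℓ) t⁻¹ = 1 - ℓ`
  have h3 : t * ((1 - ℓ) * t⁻¹) = 1 - ℓ := by field_simp
  -- combine: `t D ≥ min (m/c₂) 1 - C₀ Λ / L > 0`
  have hmin : min (m / c₂) 1 ≤ ℓ * (m / c₂) + (1 - ℓ) := by
    have hmc : min (m / c₂) 1 ≤ m / c₂ := min_le_left _ _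
    have h1' : min (m / c₂) 1 ≤ 1 := min_le_right _ _
    nlinarith
  have hminpos : 0 < min (m / c₂) 1 := lt_min (div_pos hm hc₂) one_pos
  have key : 0 < t * (deriv (logCutoff L) t * (log (r t) - log t) +
      logCutoff L t * (r' / r t) + (1 - logCutoff L t) * t⁻¹) := by
    have hsplit : t * (deriv (logCutoff L) t * (log (r t) - log t) +
        logCutoff L t * (r' / r t) + (1 - logCutoff L t) * t⁻¹) =
        t * (deriv (logCutoff L) t * (log (r t) - log t)) + t * (ℓ * (r' / r t)) +
          t * ((1 - ℓ) * t⁻¹) := by rw [hℓ]; ring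
    rw [hsplit, h3]
    have hneg := neg_abs_le (t * (deriv (logCutoff L) t * (log (r t) - log t)))
    have : smoothTransitionDerivBound / L * max |log c₁| |log c₂| =
        smoothTransitionDerivBound * max |log c₁| |log c₂| / L := by ring
    rw [this] at h1
    linarith
  exact pos_of_mul_pos_right key ht.le

/-- Values of the blend lie between `r t` and `t` on a logarithmic scale; in particular
`β ≤ max (r t) t`. [folklore] -/
theorem logBlend_le_max (ht : 0 < t) (hr : 0 < r t) : logBlend L r t ≤ max (r t) t := by
  rw [logBlend]
  have hℓ0 := logCutoff_nonneg L t
  have hℓ1 := logCutoff_le_one L t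
  have : logCutoff L t * log (r t) + (1 - logCutoff L t) * log t ≤ log (max (r t) t) := by
    have h1 : log (r t) ≤ log (max (r t) t) := log_le_log hr (le_max_left _ _)
    have h2 : log t ≤ log (max (r t) t) := log_le_log ht (le_max_right _ _)
    nlinarith
  calc exp _ ≤ exp (log (max (r t) t)) := exp_le_exp.2 this
    _ = max (r t) t := exp_log (lt_max_of_lt_left hr)

/-- Symmetrically `min (r t) t ≤ β`. [folklore] -/
theorem min_le_logBlend (ht : 0 < t) (hr : 0 < r t) : min (r t) t ≤ logBlend L r t := by
  rw [logBlend]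
  have hℓ0 := logCutoff_nonneg L t
  have hℓ1 := logCutoff_le_one L t
  have : log (min (r t) t) ≤ logCutoff L t * log (r t) + (1 - logCutoff L t) * log t := by
    have h1 : log (min (r t) t) ≤ log (r t) := log_le_log (lt_min hr ht) (min_le_left _ _)
    have h2 : log (min (r t) t) ≤ log t := log_le_log (lt_min hr ht) (min_le_right _ _)
    nlinarith
  calc min (r t) t = exp (log (min (r t) t)) := (exp_log (lt_min hr ht)).symm
    _ ≤ exp _ := exp_le_exp.2 this

end Blend

/-! ### §2 Calculus on the cylinder `Σ × ℝ`: partial derivatives in the height, compactness -/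

section Cylinder

/-- Local notation: `𝔼 n` is the model Euclidean space `EuclideanSpace ℝ (Fin n)`. -/
local notation "𝔼 " n:arg => EuclideanSpace ℝ (Fin n)

/-- `C^m` maps on a product of model vector spaces, for the product model with corners, are
`C^m` in the usual sense (Mathlib's `modelWithCornersSelf_prod` / `chartedSpaceSelf_prod`).
[folklore]  (Private copy of the identical
`Literature.Topology.FourManifolds.contDiffOn_of_contMDiffOn_prod_self`,
`CircleFamilyCoordinates.lean`, to keep the imports of this file small.) -/
private theorem contDiffOn_of_contMDiffOn_prodSelf {E F G : Type*} [NormedAddCommGroup E]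
    [NormedSpace ℝ E] [NormedAddCommGroup F] [NormedSpace ℝ F] [NormedAddCommGroup G]
    [NormedSpace ℝ G] {m : WithTop ℕ∞} {g : E × F → G} {s : Set (E × F)}
    (hg : ContMDiffOn (𝓘(ℝ, E).prod 𝓘(ℝ, F)) 𝓘(ℝ, G) m g s) : ContDiffOn ℝ m g s := by
  rw [← modelWithCornersSelf_prod, chartedSpaceSelf_prod] at hg
  exact contMDiffOn_iff_contDiffOn.1 hg

/-- Conversely, `C^m` maps on a product of model vector spaces are `C^m` for the product model.
[folklore] -/
theorem contMDiffOn_prod_self_of_contDiffOn {E F G : Type*} [NormedAddCommGroup E]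
    [NormedSpace ℝ E] [NormedAddCommGroup F] [NormedSpace ℝ F] [NormedAddCommGroup G]
    [NormedSpace ℝ G] {m : WithTop ℕ∞} {g : E × F → G} {s : Set (E × F)}
    (hg : ContDiffOn ℝ m g s) : ContMDiffOn (𝓘(ℝ, E).prod 𝓘(ℝ, F)) 𝓘(ℝ, G) m g s := by
  rw [← modelWithCornersSelf_prod, chartedSpaceSelf_prod]
  exact contMDiffOn_iff_contDiffOn.2 hg

/-- Maps into a product of model vector spaces: the same conversion on the target side.
[folklore] -/
theorem contMDiffOn_into_prod_self_iff {E F G : Type*} [NormedAddCommGroup E]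
    [NormedSpace ℝ E] [NormedAddCommGroup F] [NormedSpace ℝ F] [NormedAddCommGroup G]
    [NormedSpace ℝ G] {m : WithTop ℕ∞} {g : G → E × F} {s : Set G} :
    ContMDiffOn 𝓘(ℝ, G) (𝓘(ℝ, E).prod 𝓘(ℝ, F)) m g s ↔ ContDiffOn ℝ m g s := by
  rw [← modelWithCornersSelf_prod, chartedSpaceSelf_prod]
  exact contMDiffOn_iff_contDiffOn

/-- The **partial derivative in the height** of a function on the cylinder `Σ × ℝ`:
`∂ₜF (x, t) = d/dτ F (x, τ)` at `τ = t`. [folklore] -/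
def partialT {S : Type*} (F : S × ℝ → ℝ) (q : S × ℝ) : ℝ := deriv (fun τ : ℝ => F (q.1, τ)) q.2

/-- Unfolding lemma. [folklore] -/
theorem partialT_apply {S : Type*} (F : S × ℝ → ℝ) (x : S) (t : ℝ) :
    partialT F (x, t) = deriv (fun τ : ℝ => F (x, τ)) t := rfl

variable {n : ℕ} {S : Type*} [TopologicalSpace S] [ChartedSpace (𝔼 n) S] [IsManifold (𝓡 n) ∞ S]

/-- **A smooth function on the cylinder read in a chart of the base**: for `x₀ : Σ`, the map
`(u, τ) ↦ F (φ⁻¹ u, τ)` (`φ` the extended chart at `x₀`) is `C^∞` on `φ.target × ℝ`.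
[folklore] -/
theorem contDiffOn_comp_extChartAt_symm_prod {F : S × ℝ → ℝ}
    (hF : ContMDiff ((𝓡 n).prod 𝓘(ℝ, ℝ)) 𝓘(ℝ, ℝ) ∞ F) (x₀ : S) :
    ContDiffOn ℝ ∞ (fun p : 𝔼 n × ℝ => F ((extChartAt (𝓡 n) x₀).symm p.1, p.2))
      ((extChartAt (𝓡 n) x₀).target ×ˢ univ) := by
  have h1 : ContMDiffOn (𝓘(ℝ, 𝔼 n).prod 𝓘(ℝ, ℝ)) ((𝓡 n).prod 𝓘(ℝ, ℝ)) ∞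
      (Prod.map (extChartAt (𝓡 n) x₀).symm (id : ℝ → ℝ)) ((extChartAt (𝓡 n) x₀).target ×ˢ univ) :=
    (contMDiffOn_extChartAt_symm x₀).prodMap contMDiffOn_id
  exact contDiffOn_of_contMDiffOn_prodSelf (hF.comp_contMDiffOn h1)

/-- **The height derivative through a chart**: near a point of the chart domain, the partial
derivative `∂ₜF (x, t)` is the derivative of the chart expression in the direction `(0, 1)`,
and `τ ↦ F (x, τ)` has this derivative. [folklore] -/
theorem hasDerivAt_snd_of_contMDiff {F : S × ℝ → ℝ}
    (hF : ContMDiff ((𝓡 n).prod 𝓘(ℝ, ℝ)) 𝓘(ℝ, ℝ) ∞ F) (x₀ : S) {x : S}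
    (hx : x ∈ (extChartAt (𝓡 n) x₀).source) (t : ℝ) :
    HasDerivAt (fun τ : ℝ => F (x, τ))
      (fderiv ℝ (fun p : 𝔼 n × ℝ => F ((extChartAt (𝓡 n) x₀).symm p.1, p.2))
        ((extChartAt (𝓡 n) x₀) x, t) ((0 : 𝔼 n), (1 : ℝ))) t := by
  set φ := extChartAt (𝓡 n) x₀ with hφ
  set Ft : 𝔼 n × ℝ → ℝ := fun p => F (φ.symm p.1, p.2) with hFt
  have hopen : IsOpen (φ.target ×ˢ (univ : Set ℝ)) :=
    (isOpen_extChartAt_target x₀).prod isOpen_univ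
  have hmem : (φ x, t) ∈ φ.target ×ˢ (univ : Set ℝ) := ⟨φ.map_source hx, mem_univ _⟩
  have hd : HasFDerivAt Ft (fderiv ℝ Ft (φ x, t)) (φ x, t) :=
    (((contDiffOn_comp_extChartAt_symm_prod hF x₀).differentiableOn (by simp)).differentiableAt
      (hopen.mem_nhds hmem)).hasFDerivAt
  have hline : HasDerivAt (fun τ : ℝ => ((φ x, τ) : 𝔼 n × ℝ)) ((0 : 𝔼 n), (1 : ℝ)) t :=
    (hasDerivAt_const t (φ x)).prodMk (hasDerivAt_id' t)
  have hcomp := hd.comp_hasDerivAt t hline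
  have heq : (fun τ : ℝ => F (x, τ)) = Ft ∘ fun τ : ℝ => ((φ x, τ) : 𝔼 n × ℝ) := by
    funext τ
    simp [hFt, φ.left_inv hx]
  rw [heq]
  exact hcomp

/-- The height derivative through a chart, as an identity. [folklore] -/
theorem partialT_eq_fderiv {F : S × ℝ → ℝ} (hF : ContMDiff ((𝓡 n).prod 𝓘(ℝ, ℝ)) 𝓘(ℝ, ℝ) ∞ F)
    (x₀ : S) {x : S} (hx : x ∈ (extChartAt (𝓡 n) x₀).source) (t : ℝ) :
    partialT F (x, t) = fderiv ℝ (fun p : 𝔼 n × ℝ => F ((extChartAt (𝓡 n) x₀).symm p.1, p.2))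
      ((extChartAt (𝓡 n) x₀) x, t) ((0 : 𝔼 n), (1 : ℝ)) :=
  (hasDerivAt_snd_of_contMDiff hF x₀ hx t).deriv

/-- `τ ↦ F (x, τ)` is differentiable with derivative `∂ₜF (x, τ)`. [folklore] -/
theorem hasDerivAt_partialT {F : S × ℝ → ℝ} (hF : ContMDiff ((𝓡 n).prod 𝓘(ℝ, ℝ)) 𝓘(ℝ, ℝ) ∞ F)
    (x : S) (t : ℝ) : HasDerivAt (fun τ : ℝ => F (x, τ)) (partialT F (x, t)) t := by
  rw [partialT_eq_fderiv hF x (mem_extChartAt_source x) t]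
  exact hasDerivAt_snd_of_contMDiff hF x (mem_extChartAt_source x) t

/-- **The height derivative of a smooth function on the cylinder is continuous** (jointly in
`(x, t)`): through a chart it is the continuous derivative of the chart expression evaluated at
`(0, 1)`. [folklore] -/
theorem continuous_partialT {F : S × ℝ → ℝ} (hF : ContMDiff ((𝓡 n).prod 𝓘(ℝ, ℝ)) 𝓘(ℝ, ℝ) ∞ F) :
    Continuous (partialT F) := by
  rw [continuous_iff_continuousAt]
  rintro ⟨x₀, t₀⟩
  set φ := extChartAt (𝓡 n) x₀ with hφ
  set Ft : 𝔼 n × ℝ → ℝ := fun p => F (φ.symm p.1, p.2) with hFt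
  have hopen : IsOpen (φ.target ×ˢ (univ : Set ℝ)) :=
    (isOpen_extChartAt_target x₀).prod isOpen_univ
  -- the continuous candidate
  have hc : ContinuousOn (fun p : 𝔼 n × ℝ => fderiv ℝ Ft p ((0 : 𝔼 n), (1 : ℝ)))
      (φ.target ×ˢ (univ : Set ℝ)) :=
    ((contDiffOn_comp_extChartAt_symm_prod hF x₀).continuousOn_fderiv_of_isOpen hopen
      (by simp)).clm_apply continuousOn_const
  have hmap : ContinuousAt (fun q : S × ℝ => ((φ q.1, q.2) : 𝔼 n × ℝ)) (x₀, t₀) := by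
    refine ContinuousAt.prodMk ?_ continuousAt_snd
    exact ContinuousAt.comp (f := fun q : S × ℝ => q.1) (x := (x₀, t₀))
      (continuousAt_extChartAt (I := 𝓡 n) x₀) continuousAt_fst
  have hev : partialT F =ᶠ[𝓝 (x₀, t₀)]
      fun q : S × ℝ => fderiv ℝ Ft (φ q.1, q.2) ((0 : 𝔼 n), (1 : ℝ)) := by
    have : (fun q : S × ℝ => q.1) ⁻¹' φ.source ∈ 𝓝 (x₀, t₀) :=
      continuousAt_fst (extChartAt_source_mem_nhds x₀)
    filter_upwards [this] with q hq
    exact partialT_eq_fderiv hF x₀ hq q.2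
  refine (ContinuousAt.congr ?_ hev.symm)
  exact (hc.continuousAt (hopen.mem_nhds ⟨φ.map_source (mem_extChartAt_source x₀), mem_univ _⟩)).comp
    hmap

/-- **Mean value form of the height**: `F (x, t) - F (x, 0) = t · ∂ₜF (x, θ)` for some `θ`
strictly between `0` and `t` (`t ≠ 0`). [folklore] -/
theorem exists_partialT_eq_slope {F : S × ℝ → ℝ}
    (hF : ContMDiff ((𝓡 n).prod 𝓘(ℝ, ℝ)) 𝓘(ℝ, ℝ) ∞ F) (x : S) {t : ℝ} (ht : 0 < t) :
    ∃ θ ∈ Ioo 0 t, F (x, t) - F (x, 0) = t * partialT F (x, θ) := by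
  have hcont : Continuous fun τ : ℝ => F (x, τ) :=
    continuous_iff_continuousAt.2 fun τ => (hasDerivAt_partialT hF x τ).continuousAt
  obtain ⟨θ, hθ, hslope⟩ := exists_hasDerivAt_eq_slope (fun τ : ℝ => F (x, τ))
    (fun τ => partialT F (x, τ)) ht hcont.continuousOn (fun τ _ => hasDerivAt_partialT hF x τ)
  refine ⟨θ, hθ, ?_⟩
  rw [hslope, sub_zero, mul_div_cancel₀ _ ht.ne']

omit [IsManifold (𝓡 n) ∞ S] in
/-- **Tube lemma at the zero level**: an open subset of the cylinder containing `Σ × {0}`,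
`Σ` compact, contains a product neighbourhood `Σ × (-u, u)`. [folklore] -/
theorem exists_prod_Ioo_subset_of_isOpen [CompactSpace S] {W : Set (S × ℝ)} (hW : IsOpen W)
    (h0 : ∀ x : S, (x, (0 : ℝ)) ∈ W) : ∃ u > 0, (univ : Set S) ×ˢ Ioo (-u) u ⊆ W := by
  obtain ⟨U, V, hU, hV, hKU, h0V, hUV⟩ := generalized_tube_lemma isCompact_univ
    (isCompact_singleton (x := (0 : ℝ))) hW (fun q ⟨_, hq⟩ => by
      rw [mem_singleton_iff] at hq; obtain ⟨x, t⟩ := q; simp only at hq; subst hq; exact h0 x)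
  obtain ⟨u, hu, huV⟩ := Metric.isOpen_iff.1 hV 0 (h0V (mem_singleton _))
  refine ⟨u, hu, fun q hq => hUV ⟨hKU (mem_univ _), huV ?_⟩⟩
  simpa [Real.ball_eq_Ioo] using hq.2

omit [IsManifold (𝓡 n) ∞ S] in
/-- **Half-slab version**: if `g` is continuous on `Σ × [0, δ)` (within) and `g (x, 0)` lies
in an open set `V` for all `x`, then `g (x, t) ∈ V` for all `x` and all `t ∈ [0, u)`, for some
`u ∈ (0, δ]`. [folklore] -/
theorem exists_forall_mem_of_continuousOn [CompactSpace S] {β : Type*} [TopologicalSpace β]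
    {g : S × ℝ → β} {δ : ℝ} (hδ : 0 < δ) (hg : ContinuousOn g ((univ : Set S) ×ˢ Ico 0 δ))
    {V : Set β} (hV : IsOpen V) (h0 : ∀ x : S, g (x, 0) ∈ V) :
    ∃ u, 0 < u ∧ u ≤ δ ∧ ∀ x : S, ∀ t ∈ Ico 0 u, g (x, t) ∈ V := by
  obtain ⟨O, hO, hOeq⟩ := (continuousOn_iff'.1 hg) V hV
  -- `O ∪ {t < 0} ∪ {t ≥ δ}ᶜ`-type bookkeeping: use the open set `O ∪ (Σ × (-∞, 0))`
  have hW : IsOpen (O ∪ (univ : Set S) ×ˢ Iio (0 : ℝ)) := hO.union (isOpen_univ.prod isOpen_Iio)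
  have h0W : ∀ x : S, (x, (0 : ℝ)) ∈ O ∪ (univ : Set S) ×ˢ Iio (0 : ℝ) := by
    intro x
    left
    have : (x, (0 : ℝ)) ∈ g ⁻¹' V ∩ (univ : Set S) ×ˢ Ico 0 δ := ⟨h0 x, mem_univ _, le_rfl, hδ⟩
    rw [hOeq] at this
    exact this.1
  obtain ⟨u, hu, hsub⟩ := exists_prod_Ioo_subset_of_isOpen hW h0W
  refine ⟨min u δ, lt_min hu hδ, min_le_right _ _, fun x t ht => ?_⟩
  have htu : t < u := ht.2.trans_le (min_le_left _ _)
  have htδ : t < δ := ht.2.trans_le (min_le_right _ _)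
  have hq : (x, t) ∈ O := by
    rcases hsub (show (x, t) ∈ (univ : Set S) ×ˢ Ioo (-u) u from
      ⟨mem_univ x, by linarith [ht.1], htu⟩) with h | h
    · exact h
    · exact absurd h.2 (not_lt.2 ht.1)
  have : (x, t) ∈ O ∩ (univ : Set S) ×ˢ Ico 0 δ := ⟨hq, mem_univ _, ht.1, htδ⟩
  rw [← hOeq] at this
  exact this.1

end Cylinder

/-! ### §3 Fibrewise inverses of fibrewise monotone smooth families -/

section Fibrewise

/-- Local notation: `𝔼 n` is the model Euclidean space `EuclideanSpace ℝ (Fin n)`. -/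
local notation "𝔼 " n:arg => EuclideanSpace ℝ (Fin n)

variable {n : ℕ}

/-- **The linear algebra of a fibre-preserving map**: if `L : ℝⁿ × ℝ → ℝ` is linear with
`L (0, 1) = d ≠ 0`, then `(v, w) ↦ (v, L (v, w))` is a linear automorphism of `ℝⁿ × ℝ`, with
inverse `(v, z) ↦ (v, (z - L (v, 0)) / d)`. [folklore] -/
def fibreEquiv (L : (𝔼 n × ℝ) →L[ℝ] ℝ) (hd : L ((0 : 𝔼 n), (1 : ℝ)) ≠ 0) :
    (𝔼 n × ℝ) ≃L[ℝ] (𝔼 n × ℝ) :=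
  ContinuousLinearEquiv.equivOfInverse
    ((ContinuousLinearMap.fst ℝ (𝔼 n) ℝ).prod L)
    ((ContinuousLinearMap.fst ℝ (𝔼 n) ℝ).prod
      ((L ((0 : 𝔼 n), (1 : ℝ)))⁻¹ •
        (ContinuousLinearMap.snd ℝ (𝔼 n) ℝ -
          L.comp ((ContinuousLinearMap.fst ℝ (𝔼 n) ℝ).prod (0 : (𝔼 n × ℝ) →L[ℝ] ℝ)))))
    (by
      rintro ⟨v, w⟩
      have h1 : L (v, w) = L (v, 0) + w * L ((0 : 𝔼 n), (1 : ℝ)) := by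
        have : ((v, w) : 𝔼 n × ℝ) = (v, 0) + w • ((0 : 𝔼 n), (1 : ℝ)) := by simp
        rw [this, map_add, map_smul, smul_eq_mul]
      refine Prod.ext rfl ?_
      show (L ((0 : 𝔼 n), (1 : ℝ)))⁻¹ * (L (v, w) - L ((v, (0 : ℝ)) : 𝔼 n × ℝ)) = w
      rw [h1]
      field_simp
      ring)
    (by
      rintro ⟨v, z⟩
      have h1 : ∀ w : ℝ, L (v, w) = L (v, 0) + w * L ((0 : 𝔼 n), (1 : ℝ)) := fun w => by
        have : ((v, w) : 𝔼 n × ℝ) = (v, 0) + w • ((0 : 𝔼 n), (1 : ℝ)) := by simp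
        rw [this, map_add, map_smul, smul_eq_mul]
      refine Prod.ext rfl ?_
      show L (v, (L ((0 : 𝔼 n), (1 : ℝ)))⁻¹ * (z - L ((v, (0 : ℝ)) : 𝔼 n × ℝ))) = z
      rw [h1]
      field_simp
      ring)

/-- The forward map of `fibreEquiv` (definitional). [folklore] -/
@[simp] theorem fibreEquiv_apply (L : (𝔼 n × ℝ) →L[ℝ] ℝ) (hd : L ((0 : 𝔼 n), (1 : ℝ)) ≠ 0)
    (p : 𝔼 n × ℝ) : fibreEquiv L hd p = (p.1, L p) := rfl

/-- The forward map of `fibreEquiv` as a continuous linear map. [folklore] -/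
theorem coe_fibreEquiv (L : (𝔼 n × ℝ) →L[ℝ] ℝ) (hd : L ((0 : 𝔼 n), (1 : ℝ)) ≠ 0) :
    (fibreEquiv L hd : (𝔼 n × ℝ) →L[ℝ] (𝔼 n × ℝ)) = (ContinuousLinearMap.fst ℝ (𝔼 n) ℝ).prod L :=
  rfl

variable {S : Type*} [TopologicalSpace S] [ChartedSpace (𝔼 n) S] [IsManifold (𝓡 n) ∞ S]

/-- **Fibrewise inverse function theorem on the cylinder.** Let `g : Σ × ℝ → ℝ` be `C^∞` with
`∂ₜg > 0` on `Σ × (a, b)`.  Then each `g (x, ·)` is strictly increasing on `(a, b)`, the set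
`{(x, s) | s = g (x, t), t ∈ (a, b)}` is open, and the fibrewise inverse
`(x, s) ↦ t` is `C^∞` on it (inverse function theorem for `(u, t) ↦ (u, g (φ⁻¹ u, t))` in the
charts `φ` of `Σ`, `exists_openPartialHomeomorph_of_injOn`). [folklore] -/
theorem exists_fibrewise_inverse {g : S × ℝ → ℝ} (hg : ContMDiff ((𝓡 n).prod 𝓘(ℝ, ℝ)) 𝓘(ℝ, ℝ) ∞ g)
    {a b : ℝ} (hpos : ∀ x : S, ∀ t ∈ Ioo a b, 0 < partialT g (x, t)) :
    ∃ ginv : S × ℝ → ℝ,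
      (∀ x : S, StrictMonoOn (fun t : ℝ => g (x, t)) (Ioo a b)) ∧
      (∀ x : S, ∀ t ∈ Ioo a b, ginv (x, g (x, t)) = t) ∧
      (∀ x : S, ∀ s : ℝ, (∃ t ∈ Ioo a b, g (x, t) = s) →
        ginv (x, s) ∈ Ioo a b ∧ g (x, ginv (x, s)) = s) ∧
      IsOpen {q : S × ℝ | ∃ t ∈ Ioo a b, g (q.1, t) = q.2} ∧
      ContMDiffOn ((𝓡 n).prod 𝓘(ℝ, ℝ)) 𝓘(ℝ, ℝ) ∞ ginv {q : S × ℝ | ∃ t ∈ Ioo a b, g (q.1, t) = q.2} := by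
  -- strict monotonicity of the fibres
  have hmono : ∀ x : S, StrictMonoOn (fun t : ℝ => g (x, t)) (Ioo a b) := by
    intro x
    refine strictMonoOn_of_deriv_pos (convex_Ioo a b) ?_ fun t ht => ?_
    · exact continuousOn_of_forall_continuousAt fun t _ =>
        (hasDerivAt_partialT hg x t).continuousAt
    · rw [interior_Ioo] at ht
      rw [(hasDerivAt_partialT hg x t).deriv]
      exact hpos x t ht
  -- the inverse, by choice
  classical
  set ginv : S × ℝ → ℝ := fun q =>
    if h : ∃ t ∈ Ioo a b, g (q.1, t) = q.2 then h.choose else 0 with hginv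
  have hspec : ∀ x : S, ∀ s : ℝ, (∃ t ∈ Ioo a b, g (x, t) = s) →
      ginv (x, s) ∈ Ioo a b ∧ g (x, ginv (x, s)) = s := by
    intro x s h
    simp only [hginv, dif_pos h]
    exact h.choose_spec
  have hleft : ∀ x : S, ∀ t ∈ Ioo a b, ginv (x, g (x, t)) = t := by
    intro x t ht
    have h : ∃ t' ∈ Ioo a b, g (x, t') = g (x, t) := ⟨t, ht, rfl⟩
    obtain ⟨h1, h2⟩ := hspec x (g (x, t)) h
    exact (hmono x).injOn h1 ht h2
  -- local structure through the inverse function theorem in a chart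
  set Img : Set (S × ℝ) := {q | ∃ t ∈ Ioo a b, g (q.1, t) = q.2} with hImg
  have hlocal : ∀ q₀ ∈ Img, ∃ O : Set (S × ℝ), IsOpen O ∧ q₀ ∈ O ∧ O ⊆ Img ∧
      ContMDiffOn ((𝓡 n).prod 𝓘(ℝ, ℝ)) 𝓘(ℝ, ℝ) ∞ ginv O := by
    rintro ⟨x₀, s₀⟩ ⟨t₀, ht₀, hgt₀⟩
    set φ := extChartAt (𝓡 n) x₀ with hφ
    set Gt : 𝔼 n × ℝ → ℝ := fun p => g (φ.symm p.1, p.2) with hGt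
    set Φ : 𝔼 n × ℝ → 𝔼 n × ℝ := fun p => (p.1, Gt p) with hΦ
    set V : Set (𝔼 n × ℝ) := φ.target ×ˢ Ioo a b with hV
    have hVo : IsOpen V := (isOpen_extChartAt_target x₀).prod isOpen_Ioo
    have hGt_smooth : ContDiffOn ℝ ∞ Gt (φ.target ×ˢ univ) :=
      contDiffOn_comp_extChartAt_symm_prod hg x₀
    have hΦ_smooth : ContDiffOn ℝ ∞ Φ V :=
      contDiffOn_fst.prodMk (hGt_smooth.mono (prod_mono Subset.rfl (subset_univ _)))
    have hΦ_inj : InjOn Φ V := by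
      rintro ⟨u, t⟩ ⟨hu, ht⟩ ⟨u', t'⟩ ⟨hu', ht'⟩ h
      simp only [hΦ, Prod.mk.injEq] at h
      obtain ⟨rfl, h2⟩ := h
      exact Prod.ext rfl ((hmono (φ.symm u)).injOn ht ht' h2)
    -- the derivative of `Φ` is a fibre equivalence
    have hGt_d : ∀ p ∈ V, HasFDerivAt Gt (fderiv ℝ Gt p) p := fun p hp =>
      ((hGt_smooth.differentiableOn (by simp)).differentiableAt
        (((isOpen_extChartAt_target x₀).prod isOpen_univ).mem_nhds ⟨hp.1, mem_univ _⟩)).hasFDerivAt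
    have hd : ∀ p ∈ V, fderiv ℝ Gt p ((0 : 𝔼 n), (1 : ℝ)) = partialT g (φ.symm p.1, p.2) := by
      rintro ⟨u, t⟩ ⟨hu, -⟩
      have hx : φ.symm u ∈ φ.source := φ.map_target hu
      rw [partialT_eq_fderiv hg x₀ hx t, φ.right_inv hu]
    have hder : ∀ p ∈ V, ∃ e : (𝔼 n × ℝ) ≃L[ℝ] (𝔼 n × ℝ), HasFDerivAt Φ (e : (𝔼 n × ℝ) →L[ℝ] _) p := by
      intro p hp
      have hne : fderiv ℝ Gt p ((0 : 𝔼 n), (1 : ℝ)) ≠ 0 := by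
        rw [hd p hp]; exact (hpos _ _ hp.2).ne'
      refine ⟨fibreEquiv (fderiv ℝ Gt p) hne, ?_⟩
      rw [coe_fibreEquiv]
      exact hasFDerivAt_fst.prodMk (hGt_d p hp)
    obtain ⟨Φh, hΦh_source, hΦh_eq, -, hΦh_symm⟩ :=
      exists_openPartialHomeomorph_of_injOn hVo hΦ_smooth hΦ_inj hder
    -- the open set `O` and the formula for `ginv` on it
    set ψ : S × ℝ → 𝔼 n × ℝ := fun q => (φ q.1, q.2) with hψ
    have hψ_cont : ContinuousOn ψ (Prod.fst ⁻¹' φ.source) :=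
      ((continuousOn_extChartAt x₀).comp continuousOn_fst fun q hq => hq).prodMk continuousOn_snd
    have hsrc_open : IsOpen (Prod.fst ⁻¹' φ.source : Set (S × ℝ)) :=
      (isOpen_extChartAt_source x₀).preimage continuous_fst
    set O : Set (S × ℝ) := Prod.fst ⁻¹' φ.source ∩ ψ ⁻¹' Φh.target with hO
    have hOo : IsOpen O := hψ_cont.isOpen_inter_preimage hsrc_open Φh.open_target
    have hformula : ∀ q ∈ O, q ∈ Img ∧ ginv q = (Φh.symm (ψ q)).2 := by
      rintro ⟨x, s⟩ ⟨hx, hq⟩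
      simp only [mem_preimage] at hx hq
      set p := Φh.symm (φ x, s) with hp
      have hpV : p ∈ V := by rw [← hΦh_source]; exact Φh.map_target hq
      have hΦp : Φ p = (φ x, s) := by rw [← hΦh_eq]; exact Φh.right_inv hq
      simp only [hΦ, Prod.mk.injEq] at hΦp
      obtain ⟨h1, h2⟩ := hΦp
      have hx' : φ.symm p.1 = x := by rw [h1]; exact φ.left_inv hx
      have hgs : g (x, p.2) = s := by rw [← hx']; exact h2
      have hex : ∃ t ∈ Ioo a b, g (x, t) = s := ⟨p.2, hpV.2, hgs⟩
      refine ⟨hex, ?_⟩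
      obtain ⟨h3, h4⟩ := hspec x s hex
      exact (hmono x).injOn h3 hpV.2 (h4.trans hgs.symm)
    refine ⟨O, hOo, ⟨mem_extChartAt_source x₀, ?_⟩, fun q hq => (hformula q hq).1, ?_⟩
    · -- `q₀ ∈ O`: `ψ q₀ = Φ (φ x₀, t₀) ∈ Φh.target`
      show ψ (x₀, s₀) ∈ Φh.target
      have hmem : ((φ x₀, t₀) : 𝔼 n × ℝ) ∈ Φh.source := by
        rw [hΦh_source]; exact ⟨φ.map_source (mem_extChartAt_source x₀), ht₀⟩
      have : Φh (φ x₀, t₀) = ψ (x₀, s₀) := by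
        rw [hΦh_eq]
        simp only [hΦ, hψ, hGt, φ.left_inv (mem_extChartAt_source x₀), hgt₀]
      rw [← this]
      exact Φh.map_source hmem
    · -- smoothness on `O`: `ginv = pr₂ ∘ Φh⁻¹ ∘ ψ`
      have h1 : ContMDiffOn ((𝓡 n).prod 𝓘(ℝ, ℝ)) (𝓘(ℝ, 𝔼 n).prod 𝓘(ℝ, ℝ)) ∞ ψ
          (Prod.fst ⁻¹' φ.source) := by
        refine ContMDiffOn.prodMk ?_ contMDiffOn_snd
        have hc := contMDiffOn_extChartAt (I := 𝓡 n) (n := ∞) (x := x₀)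
        exact hc.comp contMDiffOn_fst fun q hq => by
          rw [mem_preimage, hφ, extChartAt_source] at hq; exact hq
      have h2 : ContMDiffOn (𝓘(ℝ, 𝔼 n).prod 𝓘(ℝ, ℝ)) (𝓘(ℝ, 𝔼 n).prod 𝓘(ℝ, ℝ)) ∞ Φh.symm
          Φh.target := by
        rw [← modelWithCornersSelf_prod, chartedSpaceSelf_prod]
        exact contMDiffOn_iff_contDiffOn.2 hΦh_symm
      have h3 : ContMDiffOn ((𝓡 n).prod 𝓘(ℝ, ℝ)) (𝓘(ℝ, 𝔼 n).prod 𝓘(ℝ, ℝ)) ∞ (Φh.symm ∘ ψ) O :=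
        h2.comp (h1.mono inter_subset_left) fun q hq => hq.2
      have h4 : ContMDiffOn ((𝓡 n).prod 𝓘(ℝ, ℝ)) 𝓘(ℝ, ℝ) ∞ (fun q => (Φh.symm (ψ q)).2) O :=
        contMDiff_snd.comp_contMDiffOn h3
      exact h4.congr fun q hq => (hformula q hq).2
  refine ⟨ginv, hmono, hleft, hspec, ?_, fun q hq => ?_⟩
  · rw [isOpen_iff_forall_mem_open]
    intro q hq
    obtain ⟨O, hO, hqO, hOI, -⟩ := hlocal q hq
    exact ⟨O, hOI, hO, hqO⟩
  · obtain ⟨O, hO, hqO, hOI, hsm⟩ := hlocal q hq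
    exact (hsm.contMDiffAt (hO.mem_nhds hqO)).contMDiffWithinAt

end Fibrewise

/-! ### §4 Collar germs -/

section Germ

/-- Local notation: `𝔼 n` is the model Euclidean space `EuclideanSpace ℝ (Fin n)`. -/
local notation "𝔼 " n:arg => EuclideanSpace ℝ (Fin n)

variable {n : ℕ}

/-- **A collar germ along `Σ × {0}` in the cylinder `Σ × ℝ`.** The data: maps `Γ`, `Ψ` of the
cylinder, a height function `height` and a width `δ > 0`, such that `Γ` and `Ψ` are `C^∞` on
the slab `Σ × [0, δ)` (in the within sense, for the product model), fix `Σ × {0}` pointwise,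
carry the slab into the closed upper half cylinder and are inverse to each other there (whenever
the composite is defined), and `height`, a `C^∞` function on the whole cylinder, restricts on
the slab to the height `pr₂ ∘ Γ` of `Γ`.  This is the germ at `∂M × {0}` of the comparison
`κ₁⁻¹ ∘ κ₀` of two collars `κ₀, κ₁ : ∂M × [0, 1) → M` (Bröcker–Jänich (1982), (13.5), (13.7)),
together with a two-sided extension of its height. [cite: BrockerJanich1982, (13.7)] -/
structure CollarGerm (n : ℕ) (S : Type*) [TopologicalSpace S] [ChartedSpace (𝔼 n) S] where
  /-- The germ. -/
  Γ : S × ℝ → S × ℝ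
  /-- The inverse germ. -/
  Ψ : S × ℝ → S × ℝ
  /-- A two-sided smooth extension of the height `pr₂ ∘ Γ`. -/
  height : S × ℝ → ℝ
  /-- The width of the slab on which the germ is given. -/
  δ : ℝ
  /-- The width is positive. -/
  δ_pos : 0 < δ
  /-- `Γ` is `C^∞` on the slab `Σ × [0, δ)`. -/
  contMDiffOn_Γ : ContMDiffOn ((𝓡 n).prod 𝓘(ℝ, ℝ)) ((𝓡 n).prod 𝓘(ℝ, ℝ)) ∞ Γ (univ ×ˢ Ico 0 δ)
  /-- `Ψ` is `C^∞` on the slab `Σ × [0, δ)`. -/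
  contMDiffOn_Ψ : ContMDiffOn ((𝓡 n).prod 𝓘(ℝ, ℝ)) ((𝓡 n).prod 𝓘(ℝ, ℝ)) ∞ Ψ (univ ×ˢ Ico 0 δ)
  /-- The height is `C^∞` on the whole cylinder. -/
  contMDiff_height : ContMDiff ((𝓡 n).prod 𝓘(ℝ, ℝ)) 𝓘(ℝ, ℝ) ∞ height
  /-- `Γ` fixes the zero level pointwise. -/
  Γ_zero : ∀ x, Γ (x, 0) = (x, 0)
  /-- `Ψ` fixes the zero level pointwise. -/
  Ψ_zero : ∀ x, Ψ (x, 0) = (x, 0)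
  /-- `Γ` carries the slab into the closed upper half cylinder. -/
  Γ_snd_nonneg : ∀ x, ∀ t ∈ Ico 0 δ, 0 ≤ (Γ (x, t)).2
  /-- `Ψ` carries the slab into the closed upper half cylinder. -/
  Ψ_snd_nonneg : ∀ x, ∀ t ∈ Ico 0 δ, 0 ≤ (Ψ (x, t)).2
  /-- `Ψ ∘ Γ = id` on the slab, where defined. -/
  Ψ_Γ : ∀ x, ∀ t ∈ Ico 0 δ, (Γ (x, t)).2 < δ → Ψ (Γ (x, t)) = (x, t)
  /-- `Γ ∘ Ψ = id` on the slab, where defined. -/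
  Γ_Ψ : ∀ x, ∀ t ∈ Ico 0 δ, (Ψ (x, t)).2 < δ → Γ (Ψ (x, t)) = (x, t)
  /-- On the slab the height function is the height of `Γ`. -/
  height_eq : ∀ x, ∀ t ∈ Ico 0 δ, height (x, t) = (Γ (x, t)).2

namespace CollarGerm

variable {S : Type*} [TopologicalSpace S] [ChartedSpace (𝔼 n) S] (C : CollarGerm n S)

/-- The height vanishes on the zero level. [folklore] -/
theorem height_zero (x : S) : C.height (x, 0) = 0 := by
  rw [C.height_eq x 0 ⟨le_rfl, C.δ_pos⟩, C.Γ_zero]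

/-- The height is nonnegative on the slab. [folklore] -/
theorem height_nonneg (x : S) {t : ℝ} (ht : t ∈ Ico 0 C.δ) : 0 ≤ C.height (x, t) := by
  rw [C.height_eq x t ht]; exact C.Γ_snd_nonneg x t ht

/-- `Γ` and `Ψ` are continuous on the slab. [folklore] -/
theorem continuousOn_Ψ : ContinuousOn C.Ψ (univ ×ˢ Ico 0 C.δ) := C.contMDiffOn_Ψ.continuousOn

/-- `Γ` is continuous on the slab. [folklore] -/
theorem continuousOn_Γ : ContinuousOn C.Γ (univ ×ˢ Ico 0 C.δ) := C.contMDiffOn_Γ.continuousOn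

/-- The height of `Ψ` near the zero level: `height (Ψ (x, s)) = s` whenever `(Ψ (x, s)).2 < δ`,
`s ∈ [0, δ)`. [folklore] -/
theorem height_Ψ (x : S) {s : ℝ} (hs : s ∈ Ico 0 C.δ) (hΨ : (C.Ψ (x, s)).2 < C.δ) :
    C.height (C.Ψ (x, s)) = s := by
  have hmem : (C.Ψ (x, s)).2 ∈ Ico 0 C.δ := ⟨C.Ψ_snd_nonneg x s hs, hΨ⟩
  have := C.height_eq (C.Ψ (x, s)).1 (C.Ψ (x, s)).2 hmem
  rw [Prod.mk.eta] at this
  rw [this, C.Γ_Ψ x s hs hΨ]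

variable [IsManifold (𝓡 n) ∞ S]

/-- **The normal derivative of the height is positive along the zero level.** The function
`t ↦ height (x, t)` is nonnegative on `[0, δ)` and vanishes at `0`, so its derivative at `0`
is nonnegative; it is nonzero because, differentiating `height (Ψ (x, s)) = s` at `s = 0⁺`
in a chart, `1 = d(height)_{(x,0)} (Ψ'(0⁺)) = (Ψ'(0⁺))₂ · ∂ₜheight (x, 0)` (the differential
of the height vanishes on `Σ × {0}`, where the height is identically zero). [folklore] -/
theorem partialT_height_zero_pos (x : S) : 0 < partialT C.height (x, 0) := by
  set lam := partialT C.height (x, 0) with hlam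
  have hder : HasDerivAt (fun τ : ℝ => C.height (x, τ)) lam 0 := hasDerivAt_partialT C.contMDiff_height x 0
  -- (1) nonnegativity: one-sided minimum at `0`
  have hnonneg : 0 ≤ lam := by
    have hmin : IsLocalMinOn (fun τ : ℝ => C.height (x, τ)) (Ici 0) 0 := by
      have : Ico 0 C.δ ∈ 𝓝[Ici (0 : ℝ)] (0 : ℝ) := Ico_mem_nhdsGE C.δ_pos
      filter_upwards [this] with τ hτ
      rw [C.height_zero]
      exact C.height_nonneg x hτ
    have h1 : (1 : ℝ) ∈ posTangentConeAt (Ici (0 : ℝ)) 0 := by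
      have hseg : segment ℝ (0 : ℝ) (0 + 1) ⊆ Ici 0 := fun y hy => by
        rw [zero_add, segment_eq_Icc (zero_le_one' ℝ)] at hy; exact hy.1
      exact mem_posTangentConeAt_of_segment_subset hseg
    have := hmin.hasFDerivWithinAt_nonneg hder.hasFDerivAt.hasFDerivWithinAt h1
    simpa using this
  -- (2) nonvanishing: differentiate `height (Ψ (x, s)) = s` at `0⁺` through the chart at `x`
  have hne : lam ≠ 0 := by
    set φ := extChartAt (𝓡 n) x with hφ
    set Ht : 𝔼 n × ℝ → ℝ := fun p => C.height (φ.symm p.1, p.2) with hHt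
    have hopen : IsOpen (φ.target ×ˢ (univ : Set ℝ)) :=
      (isOpen_extChartAt_target x).prod isOpen_univ
    have hHt_smooth : ContDiffOn ℝ ∞ Ht (φ.target ×ˢ univ) :=
      contDiffOn_comp_extChartAt_symm_prod C.contMDiff_height x
    have hHt_d : HasFDerivAt Ht (fderiv ℝ Ht (φ x, 0)) (φ x, 0) :=
      ((hHt_smooth.differentiableOn (by simp)).differentiableAt
        (hopen.mem_nhds ⟨φ.map_source (mem_extChartAt_source x), mem_univ _⟩)).hasFDerivAt
    set D := fderiv ℝ Ht (φ x, 0) with hD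
    -- `D (v, 0) = 0`: the height vanishes identically on the zero level
    have hDv : ∀ v : 𝔼 n, D (v, 0) = 0 := by
      intro v
      have hline : HasDerivAt (fun r : ℝ => ((φ x + r • v, (0 : ℝ)) : 𝔼 n × ℝ)) (v, 0) 0 := by
        refine HasDerivAt.prodMk ?_ (hasDerivAt_const _ _)
        simpa using ((hasDerivAt_id (0 : ℝ)).smul_const v).const_add (φ x)
      have hcomp := hHt_d.comp_hasDerivAt_of_eq (x := (0 : ℝ)) hline (by simp)
      have hzero : (Ht ∘ fun r : ℝ => ((φ x + r • v, (0 : ℝ)) : 𝔼 n × ℝ)) =ᶠ[𝓝 0] fun _ => 0 := by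
        have hcont : Tendsto (fun r : ℝ => φ x + r • v) (𝓝 0) (𝓝 (φ x)) := by
          have : Continuous fun r : ℝ => φ x + r • v := by fun_prop
          simpa using this.tendsto 0
        have hmem : φ.target ∈ 𝓝 (φ x) :=
          (isOpen_extChartAt_target x).mem_nhds (φ.map_source (mem_extChartAt_source x))
        filter_upwards [hcont.eventually hmem] with r hr
        simp only [comp_apply, hHt]
        exact C.height_zero _
      have h0 : HasDerivAt (Ht ∘ fun r : ℝ => ((φ x + r • v, (0 : ℝ)) : 𝔼 n × ℝ)) 0 0 :=
        (hasDerivAt_const (0 : ℝ) (0 : ℝ)).congr_of_eventuallyEq hzero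
      exact hcomp.unique h0
    -- `D (0, 1) = lam`
    have hD1 : D ((0 : 𝔼 n), (1 : ℝ)) = lam := by
      rw [hlam, partialT_eq_fderiv C.contMDiff_height x (mem_extChartAt_source x) 0]
    -- the curve `c s = (φ (Ψ (x, s)).1, (Ψ (x, s)).2)` and its one-sided derivative at `0`
    set c : ℝ → 𝔼 n × ℝ := fun s => (φ (C.Ψ (x, s)).1, (C.Ψ (x, s)).2) with hc
    have hΨc : ContMDiffWithinAt 𝓘(ℝ, ℝ) ((𝓡 n).prod 𝓘(ℝ, ℝ)) ∞ (fun s : ℝ => C.Ψ (x, s))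
        (Ico 0 C.δ) 0 := by
      have h1 : ContMDiffWithinAt 𝓘(ℝ, ℝ) ((𝓡 n).prod 𝓘(ℝ, ℝ)) ∞ (fun s : ℝ => ((x, s) : S × ℝ))
          (Ico 0 C.δ) 0 := (contMDiff_const.prodMk contMDiff_id).contMDiffAt.contMDiffWithinAt
      exact (C.contMDiffOn_Ψ (x, 0) ⟨mem_univ _, le_rfl, C.δ_pos⟩).comp 0 h1
        fun s hs => ⟨mem_univ _, hs⟩
    have hfst : ContMDiffWithinAt 𝓘(ℝ, ℝ) (𝓡 n) ∞ (Prod.fst ∘ fun s : ℝ => C.Ψ (x, s))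
        (Ico 0 C.δ) 0 := contMDiffAt_fst.comp_contMDiffWithinAt 0 hΨc
    have hφ' : ContMDiffAt (𝓡 n) 𝓘(ℝ, 𝔼 n) ∞ φ ((Prod.fst ∘ fun s : ℝ => C.Ψ (x, s)) 0) := by
      have : (Prod.fst ∘ fun s : ℝ => C.Ψ (x, s)) 0 = x := by simp [C.Ψ_zero]
      rw [this]
      exact contMDiffAt_extChartAt
    have hc1 : ContMDiffWithinAt 𝓘(ℝ, ℝ) 𝓘(ℝ, 𝔼 n) ∞ (φ ∘ (Prod.fst ∘ fun s : ℝ => C.Ψ (x, s)))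
        (Ico 0 C.δ) 0 := hφ'.comp_contMDiffWithinAt 0 hfst
    have hc2 : ContMDiffWithinAt 𝓘(ℝ, ℝ) 𝓘(ℝ, ℝ) ∞ (Prod.snd ∘ fun s : ℝ => C.Ψ (x, s))
        (Ico 0 C.δ) 0 := contMDiffAt_snd.comp_contMDiffWithinAt 0 hΨc
    have hcd : DifferentiableWithinAt ℝ c (Ico 0 C.δ) 0 := by
      have h1 := (contMDiffWithinAt_iff_contDiffWithinAt.1 hc1).differentiableWithinAt (by simp)
      have h2 := (contMDiffWithinAt_iff_contDiffWithinAt.1 hc2).differentiableWithinAt (by simp)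
      exact h1.prodMk h2
    have hc0 : c 0 = (φ x, 0) := by simp [hc, C.Ψ_zero]
    have hcder : HasDerivWithinAt c (derivWithin c (Ico 0 C.δ) 0) (Ici 0) 0 := by
      have := hcd.hasDerivWithinAt
      rwa [← Ici_inter_Iio, hasDerivWithinAt_inter (Iio_mem_nhds C.δ_pos)] at this
    set w := derivWithin c (Ico 0 C.δ) 0 with hw
    -- chain rule: `height ∘ Ψ (x, ·) = Ht ∘ c` near `0⁺`, derivative `D w`
    have hcomp : HasDerivWithinAt (Ht ∘ c) (D w) (Ici 0) 0 := by
      have := hHt_d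
      rw [← hc0] at this
      exact this.comp_hasDerivWithinAt 0 hcder
    -- but `height (Ψ (x, s)) = s` for small `s ≥ 0`, so the derivative is `1`
    have hid : HasDerivWithinAt (Ht ∘ c) 1 (Ici 0) 0 := by
      -- `s ↦ (Ψ (x, s)).2 < δ` and `(Ψ (x, s)).1 ∈ φ.source` for small `s ≥ 0`
      have hcont : ContinuousWithinAt (fun s : ℝ => C.Ψ (x, s)) (Ico 0 C.δ) 0 := hΨc.continuousWithinAt
      have hev : ∀ᶠ s in 𝓝[Ici (0 : ℝ)] 0, s ∈ Ico 0 C.δ ∧ (C.Ψ (x, s)).2 < C.δ ∧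
          (C.Ψ (x, s)).1 ∈ φ.source := by
        have h1 : ∀ᶠ s in 𝓝[Ici (0 : ℝ)] 0, s ∈ Ico 0 C.δ := Ico_mem_nhdsGE C.δ_pos
        have hcont' : ContinuousWithinAt (fun s : ℝ => C.Ψ (x, s)) (Ici 0) 0 := by
          rw [← Ici_inter_Iio] at hcont
          exact (continuousWithinAt_inter (Iio_mem_nhds C.δ_pos)).1 hcont
        have h0 : C.Ψ (x, 0) = (x, 0) := C.Ψ_zero x
        have h2 : ∀ᶠ s in 𝓝[Ici (0 : ℝ)] 0, (C.Ψ (x, s)).2 < C.δ := by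
          have : {q : S × ℝ | q.2 < C.δ} ∈ 𝓝 (C.Ψ (x, 0)) := by
            rw [h0]; exact (isOpen_lt continuous_snd continuous_const).mem_nhds C.δ_pos
          exact hcont' this
        have h3 : ∀ᶠ s in 𝓝[Ici (0 : ℝ)] 0, (C.Ψ (x, s)).1 ∈ φ.source := by
          have : {q : S × ℝ | q.1 ∈ φ.source} ∈ 𝓝 (C.Ψ (x, 0)) := by
            rw [h0]; exact (isOpen_extChartAt_source x).preimage continuous_fst |>.mem_nhds
              (mem_extChartAt_source x)
          exact hcont' this
        exact (h1.and (h2.and h3))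
      refine (hasDerivWithinAt_id (0 : ℝ) (Ici 0)).congr_of_eventuallyEq ?_ ?_
      · filter_upwards [hev] with s ⟨hs, hs2, hs1⟩
        simp only [comp_apply, hHt, hc, φ.left_inv hs1, Prod.mk.eta, id]
        exact C.height_Ψ x hs hs2
      · simp [hHt, hc, C.Ψ_zero, C.height_zero]
    have huniq : D w = 1 :=
      (uniqueDiffOn_Ici (0 : ℝ)).uniqueDiffWithinAt self_mem_Ici |>.eq_deriv _ hcomp hid
    -- decompose `w = (w.1, 0) + w.2 • (0, 1)`
    intro hlam0
    have hdecomp : (w : 𝔼 n × ℝ) = (w.1, 0) + w.2 • ((0 : 𝔼 n), (1 : ℝ)) := by simp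
    rw [hdecomp, map_add, map_smul, hDv w.1, hD1, hlam0, smul_zero, add_zero] at huniq
    exact zero_ne_one huniq
  exact lt_of_le_of_ne hnonneg (Ne.symm hne)

/-- **Uniform bounds for the normal derivative of the height near the zero level** (compact
`Σ`): there are `0 < t₀ < δ` and `0 < m ≤ Mu` with `m ≤ ∂ₜheight ≤ Mu` on `Σ × (-t₀, t₀)`.
[folklore] -/
theorem exists_bounds [CompactSpace S] [Nonempty S] : ∃ t₀ m Mu : ℝ, 0 < t₀ ∧ t₀ < C.δ ∧ 0 < m ∧ m ≤ Mu ∧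
    ∀ x : S, ∀ t ∈ Ioo (-t₀) t₀, m ≤ partialT C.height (x, t) ∧ partialT C.height (x, t) ≤ Mu := by
  have hcont : Continuous (partialT C.height) := continuous_partialT C.contMDiff_height
  have hcont0 : Continuous fun x : S => partialT C.height (x, 0) :=
    hcont.comp (Continuous.prodMk_left (0 : ℝ))
  obtain ⟨xm, -, hxm⟩ := isCompact_univ.exists_isMinOn univ_nonempty hcont0.continuousOn
  obtain ⟨xM, -, hxM⟩ := isCompact_univ.exists_isMaxOn univ_nonempty hcont0.continuousOn
  set m₀ := partialT C.height (xm, 0) with hm₀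
  set M₀ := partialT C.height (xM, 0) with hM₀
  have hm₀pos : 0 < m₀ := C.partialT_height_zero_pos xm
  have hmM : m₀ ≤ M₀ := isMinOn_iff.1 hxm xM (mem_univ xM)
  set W : Set (S × ℝ) := partialT C.height ⁻¹' Ioo (m₀ / 2) (2 * M₀) with hW
  have hWo : IsOpen W := isOpen_Ioo.preimage hcont
  have h0W : ∀ x : S, (x, (0 : ℝ)) ∈ W := fun x => by
    have h1 : partialT C.height (xm, 0) ≤ partialT C.height (x, 0) := isMinOn_iff.1 hxm x (mem_univ x)
    have h2 : partialT C.height (x, 0) ≤ partialT C.height (xM, 0) := isMaxOn_iff.1 hxM x (mem_univ x)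
    have h3 : 0 < partialT C.height (x, 0) := C.partialT_height_zero_pos x
    exact ⟨by linarith, by linarith⟩
  obtain ⟨u, hu, hsub⟩ := exists_prod_Ioo_subset_of_isOpen hWo h0W
  refine ⟨min u (C.δ / 2), m₀ / 2, 2 * M₀, lt_min hu (half_pos C.δ_pos),
    (min_le_right _ _).trans_lt (half_lt_self C.δ_pos), half_pos hm₀pos, by linarith, fun x t ht => ?_⟩
  have : (x, t) ∈ W := hsub ⟨mem_univ x, by
    constructor
    · have := min_le_left u (C.δ / 2); linarith [ht.1]
    · exact ht.2.trans_le (min_le_left _ _)⟩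
  exact ⟨this.1.le, this.2.le⟩

end CollarGerm

end Germ

end Literature.Topology.FourManifolds
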